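import Summits.ValiantsHypothesis.ValiantsHypothesis.Theorems.KPlusLogSqLawTropicalBHingeLaw

/-!
# Route `KPlusLogSqLaw`, crux `TropicalB` — the REALISABILITY DUAL (master law): no Farkas certificate against a dominant chain

HONEST FRAMING.  Helper file (seat val-sym-trop-p1 g11, cell `pub-symmetroid`, 2026-08-27) toward the registered stubs `stub_tropThin` /
`stub_tropFat` of `Cruxes/TropicalB/Lines/birth.lean` (crux `Summit.ValiantsHypothesis.ValiantsHypothesis.Theses.KPlusLogSqLaw.TropicalB`,
ledger item `stmt-ValiantsHypothesis-19771`, route `KPlusLogSqLaw`, DRAFT).  Companion of `…TropicalBHingeLaw` (same seat): a STRUCTURE law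
about chains of unique optima of an ARBITRARY dominance design, valid at every format; it bounds nothing by itself and asserts nothing about
`TropicalB` in its window, `WeakLifting`, `KPlusLogSqLaw`, `MatrixDescartes` (`stmt-ValiantsHypothesis-18050`) or `VP ≠ VNP`.

THE LAW (`master_law`).  Let `p 0, …, p n` be unique optima at integer slopes `θ 0 < ⋯ < θ n`.  A FARKAS CERTIFICATE against the chain is a
system of non-negative rational multipliers `lam k q` on pairs (chain position `k`, present competitor term `q ≠ p k`) such that
(1) INCIDENCE BALANCE: `Σ_{k,q} lam k q · (ev F (p k) − ev F q) = 0` for every entry-class weight table `F` (the winners and the losers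
use every incidence with the same total weight), and (2) PREFIX SLOPE EXCESS: every prefix sum `Σ_{k' ≤ k} Σ_q lam k' q · (S(p k') − S(q))`
(`k < n`) is `≥ 0` and the total is `0` (`S` = total exponent `TropicalCensus.slope`).  Then `lam = 0`.  This is exactly the statement
that the realisability LP of the chain (unknowns: valuations and the increasing slopes; constraints: strict dominance of `p k` at `θ k` over
every other present term) has no dual ray — typed in the direction «dominant ⇒ no certificate», which is the one used AGAINST candidate
families: exhibiting multipliers with (1) and (2) for a proposed chain and a proposed support proves that no valuation realises it.  Special
cases in the tree: the MULTI-EXCHANGE / prefix-deficit law of `…TropicalBMultiExchange` (multipliers = a bijection between the chain terms and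
a repackaging family), the Sidon / arc laws of `…TropicalBConvexPosition(Arc)` and the HINGE LAW of `…TropicalBHingeLaw` (chain-internal
relations, slopes eliminated).  PROOF: add `lam k q` times the strict dominance inequality `θ_k·(S_k − S_q) − (V_k − V_q) > 0`; the valuation
part vanishes by (1) applied to the valuation table, and the slope part `Σ_k θ_k e_k` (`e_k = Σ_q lam k q (S_k − S_q)`) is `≤ 0` by Abel
summation (`HingeLaw.abel`) since its prefix sums are `≥ 0`, its total is `0` and `θ` increases; so no multiplier can be positive.
LOCATED USE (this seat, memo HOME/val-sym-trop-p1/g11/): the hub-local oracle `py/lpreal.py` returns such certificates; e.g. the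
«sliding-window» `K = 4` architectures of the memo die at size `(1,1,1)` by 6-multiplier certificates of this form.  [folklore: LP duality /
Farkas; the packaging is the cell's]
-/

set_option linter.dupNamespace false
set_option autoImplicit false

namespace Summit.ValiantsHypothesis.ValiantsHypothesis.Theorems.KPlusLogSqLaw.MasterLaw

open Summit.ValiantsHypothesis.ValiantsHypothesis.Theorems.MatrixDescartes.Negative
open Summit.ValiantsHypothesis.ValiantsHypothesis.Theorems.KPlusLogSqLaw.ConvexPosition
open Summit.ValiantsHypothesis.ValiantsHypothesis.Theorems.KPlusLogSqLaw.HingeLaw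
open scoped BigOperators
open Finset

variable {m K : ℕ} (d : Fin K → ℕ) (v ε : Fin m → Fin m → Fin K → ℤ)

/-- Abel bound: if `e 0, …, e n` has non-negative proper prefix sums, total `0`, and `θ` is increasing on `[0, n]`, then
`Σ_{k ≤ n} θ_k e_k ≤ 0`. [folklore] -/
theorem abel_nonpos (n : ℕ) (θ e : ℕ → ℚ) (hθ : ∀ k < n, θ k ≤ θ (k + 1))
    (hpre : ∀ k < n, 0 ≤ ∑ i ∈ range (k + 1), e i) (htot : ∑ i ∈ range (n + 1), e i = 0) :
    ∑ k ∈ range (n + 1), e k * θ k ≤ 0 := by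
  rw [abel e θ n, htot, zero_mul, zero_sub, neg_nonpos]
  exact sum_nonneg fun k hk => by
    rw [mem_range] at hk
    exact mul_nonneg (hpre k hk) (by linarith [hθ k hk])

/-- **MASTER LAW (realisability dual).**  Along a chain of unique optima at strictly increasing integer slopes, no system of non-negative
multipliers on (chain position, present competitor) pairs with incidence balance, non-negative prefix slope excesses and zero total slope
excess has a positive entry. [folklore: Farkas; this cell] -/
theorem master_law (n : ℕ) (θ : ℕ → ℤ) (p : ℕ → Equiv.Perm (Fin m) × (Fin m → Fin K))
    (hdom : ∀ k ≤ n, IsDominant d v ε (θ k) (p k)) (hθ : ∀ k < n, θ k < θ (k + 1))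
    (lam : ℕ → (Equiv.Perm (Fin m) × (Fin m → Fin K)) → ℚ) (hlam : ∀ k q, 0 ≤ lam k q)
    (hpres : ∀ k ≤ n, ∀ q, lam k q ≠ 0 → termSign ε q ≠ 0 ∧ q ≠ p k)
    (hbal : ∀ F : Fin m × Fin m × Fin K → ℤ,
      ∑ k ∈ range (n + 1), ∑ q, lam k q * ((ev F (p k) : ℚ) - (ev F q : ℚ)) = 0)
    (hpre : ∀ k < n, 0 ≤ ∑ k' ∈ range (k + 1), ∑ q, lam k' q *
      ((Summit.ValiantsHypothesis.ValiantsHypothesis.Theorems.LacunarySymmetroidMatrixDescartes.TropicalCensus.slope d (p k') : ℚ) -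
       (Summit.ValiantsHypothesis.ValiantsHypothesis.Theorems.LacunarySymmetroidMatrixDescartes.TropicalCensus.slope d q : ℚ)))
    (htot : ∑ k ∈ range (n + 1), ∑ q, lam k q *
      ((Summit.ValiantsHypothesis.ValiantsHypothesis.Theorems.LacunarySymmetroidMatrixDescartes.TropicalCensus.slope d (p k) : ℚ) -
       (Summit.ValiantsHypothesis.ValiantsHypothesis.Theorems.LacunarySymmetroidMatrixDescartes.TropicalCensus.slope d q : ℚ)) = 0) :
    ∀ k ≤ n, ∀ q, lam k q = 0 := by
  -- abbreviations: slope and valuation of a term, as rationals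
  set Sl : (Equiv.Perm (Fin m) × (Fin m → Fin K)) → ℚ := fun q =>
    (Summit.ValiantsHypothesis.ValiantsHypothesis.Theorems.LacunarySymmetroidMatrixDescartes.TropicalCensus.slope d q : ℚ) with hSl
  set Vl : (Equiv.Perm (Fin m) × (Fin m → Fin K)) → ℚ := fun q => ((∑ b, v (q.1 b) b (q.2 b) : ℤ) : ℚ) with hVl
  -- each weighted dominance gap is non-negative, and positive where the multiplier is positive
  have hgap : ∀ k ≤ n, ∀ q, 0 ≤ lam k q * ((θ k : ℚ) * (Sl (p k) - Sl q) - (Vl (p k) - Vl q)) := by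
    intro k hk q
    by_cases h0 : lam k q = 0
    · rw [h0, zero_mul]
    · obtain ⟨hq, hne⟩ := hpres k hk q h0
      have hlt := bracket d v ε (hdom k hk) hq hne
      have hltq := (Int.cast_lt (R := ℚ)).mpr hlt
      push_cast at hltq
      refine mul_nonneg (hlam k q) ?_
      simp only [hSl, hVl]; push_cast; linarith
  have hgap' : ∀ k ≤ n, ∀ q, lam k q ≠ 0 → 0 < lam k q * ((θ k : ℚ) * (Sl (p k) - Sl q) - (Vl (p k) - Vl q)) := by
    intro k hk q h0
    obtain ⟨hq, hne⟩ := hpres k hk q h0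
    have hlt := bracket d v ε (hdom k hk) hq hne
    have hltq := (Int.cast_lt (R := ℚ)).mpr hlt
    push_cast at hltq
    refine mul_pos (lt_of_le_of_ne (hlam k q) (Ne.symm h0)) ?_
    simp only [hSl, hVl]; push_cast; linarith
  -- the total weighted gap
  set Φ : ℚ := ∑ k ∈ range (n + 1), ∑ q, lam k q * ((θ k : ℚ) * (Sl (p k) - Sl q) - (Vl (p k) - Vl q)) with hΦ
  -- (a) Φ ≤ 0: valuation part vanishes by balance, slope part by Abel
  have hval : ∑ k ∈ range (n + 1), ∑ q, lam k q * (Vl (p k) - Vl q) = 0 := by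
    have h := hbal fun x => v x.1 x.2.1 x.2.2
    simp only [← val_eq_ev] at h
    simp only [hVl]
    exact h
  have hslope : ∑ k ∈ range (n + 1), ∑ q, lam k q * ((θ k : ℚ) * (Sl (p k) - Sl q)) ≤ 0 := by
    have e : ∑ k ∈ range (n + 1), ∑ q, lam k q * ((θ k : ℚ) * (Sl (p k) - Sl q)) =
        ∑ k ∈ range (n + 1), (∑ q, lam k q * (Sl (p k) - Sl q)) * (θ k : ℚ) := by
      refine sum_congr rfl fun k _ => ?_
      rw [sum_mul]
      refine sum_congr rfl fun q _ => by ring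
    rw [e]
    refine abel_nonpos n (fun k => (θ k : ℚ)) (fun k => ∑ q, lam k q * (Sl (p k) - Sl q)) ?_ ?_ ?_
    · intro k hk; exact_mod_cast (hθ k hk).le
    · intro k hk; simpa [hSl] using hpre k hk
    · simpa [hSl] using htot
  have hΦle : Φ ≤ 0 := by
    have e : Φ = ∑ k ∈ range (n + 1), ∑ q, lam k q * ((θ k : ℚ) * (Sl (p k) - Sl q)) -
        ∑ k ∈ range (n + 1), ∑ q, lam k q * (Vl (p k) - Vl q) := by
      rw [hΦ, ← sum_sub_distrib]
      refine sum_congr rfl fun k _ => ?_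
      rw [← sum_sub_distrib]
      refine sum_congr rfl fun q _ => by ring
    rw [e, hval, sub_zero]; exact hslope
  -- (b) if some multiplier were positive, Φ > 0
  intro k hk q
  by_contra h0
  have hpos : 0 < Φ := by
    rw [hΦ]
    have hk' : k ∈ range (n + 1) := mem_range.mpr (by omega)
    calc (0 : ℚ) < lam k q * ((θ k : ℚ) * (Sl (p k) - Sl q) - (Vl (p k) - Vl q)) := hgap' k hk q h0
      _ ≤ ∑ q', lam k q' * ((θ k : ℚ) * (Sl (p k) - Sl q') - (Vl (p k) - Vl q')) :=
          single_le_sum (f := fun q' => lam k q' * ((θ k : ℚ) * (Sl (p k) - Sl q') - (Vl (p k) - Vl q')))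
            (fun q' _ => hgap k hk q') (mem_univ q)
      _ ≤ ∑ k' ∈ range (n + 1), ∑ q', lam k' q' * ((θ k' : ℚ) * (Sl (p k') - Sl q') - (Vl (p k') - Vl q')) :=
          single_le_sum (f := fun k' => ∑ q', lam k' q' * ((θ k' : ℚ) * (Sl (p k') - Sl q') - (Vl (p k') - Vl q')))
            (fun k' hk'' => sum_nonneg fun q' _ => hgap k' (by rw [mem_range] at hk''; omega) q') hk'
  linarith

end Summit.ValiantsHypothesis.ValiantsHypothesis.Theorems.KPlusLogSqLaw.MasterLaw
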